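import Mathlib.Analysis.Matrix.Spectrum
import Mathlib.Analysis.Matrix.PosDef
import Mathlib.Algebra.Order.Star.Real
import HarnessLib

/-!
# The finite Ando–Fejér trace inequality `tr((P²∘P²)P²) ≤ tr((P∘P³)P²)` for a real positive semidefinite matrix

Proof file (`--supports stmt-CriticalPhenomena-4575 --as helper`), lane `prim-bschramm`, seat `prim-bschramm-gen-1` gen 12 (GEN pen); item (c) of lead g29's Q-DOOR-2
(#10006/#10021), the FINITE SHADOW of Hutchcroft's diagram comparison `B_p ≤ A_p` (Hutchcroft 2022, Prop. 1.7): the refuter's lemma E-p5g35-2 (#10003; algebra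
re-checked by w-crit-1 #10008).  builds on p205010 (kernel theorem, internal audit signed; external expert review pending) — nothing here uses p205010.  Def-free;
no instance, no notation, no sorry; generic over a finite index type.

THE INEQUALITY.  For a real positive semidefinite `n × n` matrix `P`:  `Σ_{x,y} (P²)_{xy}³ ≤ Σ_{x,y} P_{xy} (P³)_{xy} (P²)_{xy}`, i.e. `tr((P²∘P²)P²) ≤ tr((P∘P³)P²)`
(`∘` = entrywise product).  PROOF (no von Neumann algebra, no Schur product theorem): diagonalise `P = U D Uᵀ` (Mathlib's spectral theorem, `λ_i ≥ 0`); then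
`S(a,b) := Σ_{x,y} (P^a)_{xy}(P^b)_{xy}(P²)_{xy} = Σ_{i,j} λ_i^a λ_j^b q_{ij}` with `q_{ij} = w_{ij}ᵀ P² w_{ij} ≥ 0`, `w_{ij}(x) = U_{xi}U_{xj}`, and
`S(1,3) + S(3,1) − 2 S(2,2) = Σ_{i,j} λ_iλ_j(λ_i − λ_j)² q_{ij} ≥ 0`, `S(1,3) = S(3,1)`.
[cite: Hutchcroft2022Triangle, Prop. 1.7 and §3 (the Schur-power inequality T²∘T² ⪯ T∘T³ and Fejér's Tr(ST) ≥ 0)] [cite: HornJohnson2013, Thm. 7.5.3 (Schur product theorem, context)]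
-/

namespace Summit.CriticalPhenomena.PercolationContinuityZ3.Theorems.Transplant

namespace TraceShadow

open Matrix

variable {n : Type} [Fintype n] [DecidableEq n]

/-- Powers of a unitarily diagonalised real matrix: `(U D Uᴴ)^{m+1} = U D^{m+1} Uᴴ` when `Uᴴ U = 1`. [folklore] -/
theorem pow_eq_of_eq_conj {P U : Matrix n n ℝ} {d : n → ℝ} (hP : P = U * diagonal d * star U) (hU : star U * U = 1) (m : ℕ) :
    P ^ (m + 1) = U * diagonal (fun i => d i ^ (m + 1)) * star U := by
  induction m with
  | zero => simp only [zero_add, pow_one, hP]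
  | succ m ih =>
    rw [pow_succ, ih, hP]
    calc U * diagonal (fun i => d i ^ (m + 1)) * star U * (U * diagonal d * star U)
        = U * diagonal (fun i => d i ^ (m + 1)) * (star U * U) * diagonal d * star U := by
          simp only [Matrix.mul_assoc]
      _ = U * diagonal (fun i => d i ^ (m + 1 + 1)) * star U := by
          have hdd : diagonal (fun i => d i ^ (m + 1)) * diagonal d = diagonal (fun i => d i ^ (m + 1 + 1)) :=
            (diagonal_mul_diagonal _ _).trans (by simp only [pow_succ])
          rw [hU, Matrix.mul_one, Matrix.mul_assoc U, hdd]

omit [DecidableEq n] in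
/-- The symmetric comparison of quadratic weights: for `λ ≥ 0` and `q ≥ 0` symmetric, `Σ_{i,j} λ_i²λ_j² q_{ij} ≤ Σ_{i,j} λ_iλ_j³ q_{ij}`
(`= ½ Σ (λ_iλ_j³ + λ_i³λ_j) q_{ij}`, and `λ_iλ_j³ + λ_i³λ_j − 2λ_i²λ_j² = λ_iλ_j(λ_i − λ_j)² ≥ 0`). [folklore] -/
theorem sum_sq_sq_le_sum_one_three {d : n → ℝ} (hd : ∀ i, 0 ≤ d i) {q : n → n → ℝ} (hq : ∀ i j, 0 ≤ q i j) (hqs : ∀ i j, q i j = q j i) :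
    ∑ i, ∑ j, d i ^ 2 * d j ^ 2 * q i j ≤ ∑ i, ∑ j, d i * d j ^ 3 * q i j := by
  have hsymm : ∑ i, ∑ j, d i ^ 3 * d j * q i j = ∑ i, ∑ j, d i * d j ^ 3 * q i j := by
    rw [Finset.sum_comm]
    exact Finset.sum_congr rfl fun i _ => Finset.sum_congr rfl fun j _ => by rw [hqs j i]; ring
  have hpt : ∀ i j, 2 * (d i ^ 2 * d j ^ 2 * q i j) ≤ d i * d j ^ 3 * q i j + d i ^ 3 * d j * q i j := by
    intro i j
    have h : 0 ≤ d i * d j * (d i - d j) ^ 2 * q i j := mul_nonneg (mul_nonneg (mul_nonneg (hd i) (hd j)) (sq_nonneg _)) (hq i j)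
    nlinarith [h]
  have h2 : 2 * ∑ i, ∑ j, d i ^ 2 * d j ^ 2 * q i j ≤ ∑ i, ∑ j, d i * d j ^ 3 * q i j + ∑ i, ∑ j, d i ^ 3 * d j * q i j := by
    rw [Finset.mul_sum, ← Finset.sum_add_distrib]
    refine Finset.sum_le_sum fun i _ => ?_
    rw [Finset.mul_sum, ← Finset.sum_add_distrib]
    exact Finset.sum_le_sum fun j _ => hpt i j
  linarith [hsymm]

omit [DecidableEq n] in
/-- Reordering a fourfold finite sum. [folklore] -/
theorem sum_four_comm (G : n → n → n → n → ℝ) : ∑ x, ∑ y, ∑ i, ∑ j, G i j x y = ∑ i, ∑ j, ∑ x, ∑ y, G i j x y := by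
  calc ∑ x, ∑ y, ∑ i, ∑ j, G i j x y = ∑ x, ∑ i, ∑ y, ∑ j, G i j x y := Finset.sum_congr rfl fun x _ => Finset.sum_comm
    _ = ∑ i, ∑ x, ∑ y, ∑ j, G i j x y := Finset.sum_comm
    _ = ∑ i, ∑ x, ∑ j, ∑ y, G i j x y := Finset.sum_congr rfl fun i _ => Finset.sum_congr rfl fun x _ => Finset.sum_comm
    _ = ∑ i, ∑ j, ∑ x, ∑ y, G i j x y := Finset.sum_congr rfl fun i _ => Finset.sum_comm

/-- **The finite Ando–Fejér trace inequality.**  For a real positive semidefinite matrix `P`: `Σ_{x,y} (P²)_{xy}³ ≤ Σ_{x,y} P_{xy}(P³)_{xy}(P²)_{xy}`, i.e.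
`tr((P² ∘ P²) P²) ≤ tr((P ∘ P³) P²)` — the finite shadow of Hutchcroft's `B_p ≤ A_p`.
[cite: Hutchcroft2022Triangle, Prop. 1.7, §3] -/
theorem sum_pow_two_cube_le (P : Matrix n n ℝ) (hP : P.PosSemidef) :
    ∑ x, ∑ y, (P ^ 2) x y ^ 3 ≤ ∑ x, ∑ y, P x y * (P ^ 3) x y * (P ^ 2) x y := by
  -- diagonalise (Mathlib's spectral theorem; cf. the tree's «RandomWalkLoopDeterminant» `RWLoopDet.pow_apply_eq_sum`)
  set U : Matrix n n ℝ := (hP.1.eigenvectorUnitary : Matrix n n ℝ) with hUdef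
  set d : n → ℝ := hP.1.eigenvalues with hd
  have hPU : P = U * diagonal d * star U := by
    have h := hP.1.spectral_theorem
    rw [Unitary.conjStarAlgAut_apply] at h
    have hdiag : (diagonal (RCLike.ofReal ∘ hP.1.eigenvalues) : Matrix n n ℝ) = diagonal d := by
      congr 1
    rw [hdiag] at h
    exact h
  have hUU : star U * U = 1 := Unitary.coe_star_mul_self hP.1.eigenvectorUnitary
  have hd0 : ∀ i, 0 ≤ d i := fun i => hP.eigenvalues_nonneg i
  -- entries of the powers: `(P^{m+1})_{xy} = Σ_i U_{xi} λ_i^{m+1} U_{yi}`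
  have hpow : ∀ (m : ℕ) (x y : n), (P ^ (m + 1)) x y = ∑ i, U x i * d i ^ (m + 1) * U y i := fun m x y => by
    rw [pow_eq_of_eq_conj hPU hUU m, Matrix.mul_apply]
    refine Finset.sum_congr rfl fun i _ => ?_
    rw [Matrix.mul_diagonal, Matrix.star_apply, star_trivial]
  -- the weights `q_{ij} = w_{ij}ᵀ P² w_{ij} ≥ 0`
  set q : n → n → ℝ := fun i j => ∑ x, ∑ y, U x i * U x j * (P ^ 2) x y * (U y i * U y j) with hq
  have hq0 : ∀ i j, 0 ≤ q i j := by
    intro i j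
    have hP2 : (P ^ 2).PosSemidef := hP.pow 2
    have h := (Matrix.posSemidef_iff_dotProduct_mulVec.1 hP2).2 (fun x => U x i * U x j)
    simp only [star_trivial, dotProduct, Matrix.mulVec, Finset.mul_sum] at h
    refine h.trans_eq ?_
    simp only [hq]
    exact Finset.sum_congr rfl fun x _ => Finset.sum_congr rfl fun y _ => by ring
  have hqs : ∀ i j, q i j = q j i := fun i j => by
    simp only [hq]
    exact Finset.sum_congr rfl fun x _ => Finset.sum_congr rfl fun y _ => by ring
  -- `Σ_{x,y} X_{xy} Y_{xy} (P²)_{xy} = Σ_{i,j} e_i f_j q_{ij}` for `X = U diag(e) Uᵀ`, `Y = U diag(f) Uᵀ`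
  have hS : ∀ (X Y : Matrix n n ℝ) (e f : n → ℝ), (∀ x y, X x y = ∑ i, U x i * e i * U y i) → (∀ x y, Y x y = ∑ j, U x j * f j * U y j) →
      ∑ x, ∑ y, X x y * Y x y * (P ^ 2) x y = ∑ i, ∑ j, e i * f j * q i j := by
    intro X Y e f hX hY
    calc ∑ x, ∑ y, X x y * Y x y * (P ^ 2) x y
        = ∑ x, ∑ y, ∑ i, ∑ j, e i * f j * (U x i * U x j * (P ^ 2) x y * (U y i * U y j)) := by
          refine Finset.sum_congr rfl fun x _ => Finset.sum_congr rfl fun y _ => ?_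
          rw [hX x y, hY x y, Finset.sum_mul_sum, Finset.sum_mul]
          refine Finset.sum_congr rfl fun i _ => ?_
          rw [Finset.sum_mul]
          exact Finset.sum_congr rfl fun j _ => by ring
      _ = ∑ i, ∑ j, ∑ x, ∑ y, e i * f j * (U x i * U x j * (P ^ 2) x y * (U y i * U y j)) := sum_four_comm _
      _ = ∑ i, ∑ j, e i * f j * q i j := by
          refine Finset.sum_congr rfl fun i _ => Finset.sum_congr rfl fun j _ => ?_
          rw [hq]
          simp only [Finset.mul_sum]
  -- the three powers
  have hpow1 : ∀ x y, P x y = ∑ i, U x i * d i * U y i := fun x y => by simpa using hpow 0 x y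
  have hpow2 : ∀ x y, (P ^ 2) x y = ∑ i, U x i * d i ^ 2 * U y i := fun x y => hpow 1 x y
  have hpow3 : ∀ x y, (P ^ 3) x y = ∑ i, U x i * d i ^ 3 * U y i := fun x y => hpow 2 x y
  -- conclude: LHS = S(2,2), RHS = S(1,3)
  have hL : ∑ x, ∑ y, (P ^ 2) x y ^ 3 = ∑ x, ∑ y, (P ^ 2) x y * (P ^ 2) x y * (P ^ 2) x y :=
    Finset.sum_congr rfl fun x _ => Finset.sum_congr rfl fun y _ => by ring
  rw [hL, hS (P ^ 2) (P ^ 2) (fun i => d i ^ 2) (fun i => d i ^ 2) hpow2 hpow2, hS P (P ^ 3) d (fun i => d i ^ 3) hpow1 hpow3]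
  exact sum_sq_sq_le_sum_one_three hd0 hq0 hqs

end TraceShadow

end Summit.CriticalPhenomena.PercolationContinuityZ3.Theorems.Transplant
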